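import Literature.AlgebraicGeometry.Motives.GAGA
import Literature.AlgebraicGeometry.Motives.ProjectiveOfGeneratingSections
import Literature.NumberTheory.Transcendental.AnalytificationFunctorialityProofs
import Literature.NumberTheory.Transcendental.AnalytificationProjProofs
import Literature.Geometry.Kaehler.FubiniStudy
import Mathlib.Geometry.Manifold.MFDeriv.Tangent
import HarnessLib

/-!
# Smooth projective varieties are Kähler (proof file for `GAGA.lean`, closed-immersion form)

Sibling proof file of `Literature/AlgebraicGeometry/Motives/GAGA.lean` (next to
`GAGAKaehlerProofs.lean`, which discharges the companion fact `isKaehlerManifold_projectivization`: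
`ℙⁿ(ℂ)` itself is Kähler). `GAGA.lean` vendors as a *named fact*
`Literature.AlgebraicGeometry.Motives.isKaehlerManifold_of_isAnalytification_of_isClosedImmersion`:
for a smooth `k`-scheme `X` (`k ⊆ ℂ`) of relative dimension `d` with a closed `k`-immersion
`ι : X ⟶ ℙᴺ_k`, every analytification `φ : M → X(ℂ)` carrying a holomorphic atlas
(`Literature.NumberTheory.Transcendental.IsAnalytification E X d φ`, `[IsManifold 𝓘(ℂ, E) ω M]`)
is a Kähler manifold (`Literature.Geometry.Kaehler.IsKaehlerManifold E M`: some smooth Riemannian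
metric on the real tangent bundle is Hermitian with closed Kähler form). This file PROVES it:
`isKaehlerManifold_of_isAnalytification_of_isClosedImmersion_holds`.

The printed source is Voisin, *Hodge Theory and Complex Algebraic Geometry I*, §3.3.2 (the
Fubini–Study metric; Lemma 3.16: its form `ω` is positive) with the corollary stated on p. 77:
«every complex projective manifold (i.e. complex submanifold of projective space) is Kähler»,
and §3.1.3 («Submanifolds»: the Hermitian metric of `M` induces one on `N` whose Kähler form
`ω_N = j^*ω_M` is closed). (The docstring of the fact cites Serre's GAGA, which constructs `X^an`
(§2) but contains no Kähler statement; Griffiths–Harris, pp. 30–31 and 109, is the other standard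
reference.)

## Proof

We do not use the manifold `ℙᴺ(ℂ)` (nor the Fubini–Study metric `FubiniStudy.fubiniStudyMetric`
of `GAGAKaehlerProofs.lean` on it, which would require the holomorphic map `M → ℙᴺ(ℂ)` and its
immersivity in Mathlib's charts of `ℙ ℂ ℂᴺ⁺¹`): the Fubini–Study form is pulled back chart by
chart from `ℂᴺ⁺¹ ∖ {0}` along the affine coordinates, using the abstract layer
`Literature/Geometry/Kaehler/FubiniStudy` (Fubini–Study form `β₀ = dα₀` of a complex inner product
space, its pull-back `fsPullback` along maps holomorphic on an open set, and
`isKaehlerManifold_of_closed_positive_form`), exactly as Voisin defines it (§3.3.1–2: the Chern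
forms `ωᵢ = (1/2iπ)∂∂̄ log hᵢ` of `𝒪(1)` on the standard opens `Uᵢ`, which «coincide on
`Uᵢ ∩ Uⱼ`»). (The coordinate calculus `FubiniStudy.fsH`, `fsH_rescale` of `GAGAKaehlerProofs.lean`
is the same Hermitian form `h_FS` written on `ℂᵐ`; the two files are independent.)

* *(algebra, Part A)* Let `r = ι.left : X → ℙᴺ_k = Proj k[x₀,…,x_N]`. The generating-sections
  datum `GeneratingSections.ofHom r` of the tree (Hartshorne II Thm. 7.1 (a)) provides the affine
  opens `Uⱼ = r⁻¹D₊(xⱼ)` covering `X` and the ratios `t_{j,i} = r^*(xᵢ/xⱼ) ∈ Γ(X, Uⱼ)` with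
  `t_{j,j} = 1`, the cocycle rule, and `X_{t_{j,l}} = Uⱼ ∩ U_l`. Since `r` is a closed immersion,
  its lift `Uⱼ → D₊(xⱼ) = Spec (k[x]_{(xⱼ)})₀` is a closed immersion (`isClosedImmersion_chartLift`),
  so `(k[x]_{(xⱼ)})₀ → Γ(X, Uⱼ)` is surjective and every regular function on `Uⱼ` is a polynomial
  in the ratios (`exists_eval_eq_eval_ratio`; Hartshorne II Prop. 7.2).
* *(the maps `Gⱼ`, Part B)* On `Mⱼ = φ⁻¹(Uⱼ(ℂ))` (an open cover of `M`) the map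
  `Gⱼ = (t_{j,i} ∘ φ)ᵢ : M → ℂᴺ⁺¹` is holomorphic (regular functions are holomorphic on an
  analytification), has `j`-th coordinate `1`, and `G_l = (t_{j,l} ∘ φ)⁻¹ · Gⱼ` on `Mⱼ ∩ M_l`.
  Hence the pulled-back Fubini–Study forms `θⱼ = Gⱼ^*β₀` (`fsPullback`) agree on overlaps
  (projective invariance `fsPullback_smul`), and `θ(m) := θ_{j(m)}(m)` is a smooth closed real
  `2`-form of type `(1,1)` with `θ(v, Jv) ≥ 0` (`FubiniStudy`, Parts 1–2).
* *(immersivity, Part B)* `θ(v, Jv) = 0` forces `dGⱼ(v) ∈ ℂ·Gⱼ(m)`, hence `dGⱼ(v) = 0` (the `j`-th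
  coordinate of `Gⱼ` is constant), hence `v = 0`: `X` being smooth over `k`, an affine open
  `V ∋ φ(m)` has a standard smooth presentation, whose free coordinates `x_f ∘ φ` form a holomorphic
  chart of `M` near `m` (Clements–Osgood, as in the tree's proof of the functoriality of `X^an`,
  `IsAnalytification.mdifferentiable_comp_map_holds`), while each `x_f` is near `φ(m)` a quotient
  of polynomials in the `t_{j,i}` (`AlgPoints.exists_eval_eq_div`), so that `d(x_f ∘ φ)_m` factors
  through `dGⱼ(m)`. (Serre, GAGA §2 n°6 Prop. 3 Cor. 2 with §1 n°4: at a simple point `X^h` is a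
  submanifold; SGA 1 XII Prop. 3.1.)
* *(conclusion, Part C)* A smooth closed positive real `(1,1)`-form is the Kähler form of the
  Kähler metric `g(v, w) = θ(v, Jw)` (`isKaehlerManifold_of_closed_positive_form`; Voisin §3.1.1
  Lemma 3.3, §3.1.2 Def. 3.6).

## References

* C. Voisin, *Hodge Theory and Complex Algebraic Geometry I* (CUP 2002), §3.1.1, §3.1.3, §3.3.1,
  §3.3.2 (Lemma 3.16 and p. 77). [VoisinHodgeI2002]
* P. Griffiths, J. Harris, *Principles of Algebraic Geometry* (1978), pp. 30–31, 109.
* J.-P. Serre, *Géométrie algébrique et géométrie analytique*, Ann. Inst. Fourier 6 (1956), §2.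
* R. Hartshorne, *Algebraic Geometry* (1977), II Thm. 7.1, II Prop. 7.2.
-/

universe u

open CategoryTheory AlgebraicGeometry Limits HomogeneousLocalization TopologicalSpace Opposite
open MvPolynomial (X C eval₂Hom)
open Literature.AlgebraicGeometry.Motives.Segre

attribute [local instance] MvPolynomial.gradedAlgebra

noncomputable section

/-! ## Part A. Algebra: the affine charts of a closed subscheme of `ℙᴺ_k` -/

namespace Literature.AlgebraicGeometry.Motives

namespace GeneratingSections

/-! ### The chart lifts of a closed immersion into `ℙ(ι)` are closed immersions; generation of
`Γ(X, r⁻¹D₊(xⱼ))` by the ratios -/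

section ChartLift

variable {ι : Type} {k : Type u} [CommRing k] {Y : Scheme.{u}} (r : Y ⟶ Proj (grading ι k))

/-- For a closed immersion `r : Y → ℙ(ι)_k`, the lift `r⁻¹D₊(xⱼ) → D₊(xⱼ) = Spec (k[x]_{(xⱼ)})₀`
of `r` over the `j`-th standard chart is a closed immersion (closed immersions are local on the
target; Hartshorne II Ex. 3.11 / II Prop. 7.2 setting). [folklore] -/
theorem isClosedImmersion_chartLift [IsClosedImmersion r] (j : ι) :
    IsClosedImmersion (chartLift r j) := by
  have hrange : Set.range (Proj.basicOpen (grading ι k) (X j)).ι = Set.range (chartι k j) := by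
    rw [Scheme.Opens.range_ι, ← Scheme.Hom.coe_opensRange, Proj.opensRange_awayι]
  let e := IsOpenImmersion.isoOfRangeEq (Proj.basicOpen (grading ι k) (X j)).ι (chartι k j) hrange
  have he : e.hom ≫ chartι k j = (Proj.basicOpen (grading ι k) (X j)).ι :=
    IsOpenImmersion.isoOfRangeEq_hom_fac _ _ _
  have hl : ((r ∣_ Proj.basicOpen (grading ι k) (X j)) ≫ e.hom) ≫ chartι k j = (preU r j).ι ≫ r := by
    rw [Category.assoc, he, morphismRestrict_ι]
  have hαl : (r ∣_ Proj.basicOpen (grading ι k) (X j)) ≫ e.hom = chartLift r j :=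
    IsOpenImmersion.lift_uniq _ _ _ _ hl
  rw [← hαl]
  infer_instance

/-- For a closed immersion `r : Y → ℙ(ι)_k`, pulling back functions along the chart lift,
`(k[x]_{(xⱼ)})₀ → Γ(r⁻¹D₊(xⱼ), 𝒪)`, is surjective (closed immersion into an affine scheme:
Mathlib `IsClosedImmersion.isAffine_surjective_of_isAffine`). [cite: Hartshorne1977, II Prop. 7.2] -/
theorem pull_chartLift_surjective [IsClosedImmersion r] (j : ι) :
    Function.Surjective (pull (chartLift r j)) := by
  haveI := isClosedImmersion_chartLift r j
  intro s
  obtain ⟨t, ht⟩ := (IsClosedImmersion.isAffine_surjective_of_isAffine (chartLift r j)).2 s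
  obtain ⟨u, hu⟩ := (ConcreteCategory.bijective_of_isIso
    (Scheme.ΓSpecIso (.of (Away (grading ι k) (X j)))).inv).2 t
  exact ⟨u, by rw [pull_apply, hu, ht]⟩

/-- **Sections over `r⁻¹D₊(xⱼ)` are polynomials in the ratios.** For a closed immersion
`r : Y → ℙ(ι)_k`, every `a ∈ Γ(Y, r⁻¹D₊(xⱼ))` is `p(r^*(xᵢ/xⱼ))` for a polynomial `p` with
coefficients in `k` (mapped to `Γ(Y, r⁻¹D₊(xⱼ))` by the constants of the chart lift): the chart
ring map is surjective (Hartshorne II Prop. 7.2) and `(k[x]_{(xⱼ)})₀` consists of the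
dehomogenisations `p(x/xⱼ)`. [cite: Hartshorne1977, II Prop. 7.2] -/
theorem exists_eq_eval₂_homRatio [IsClosedImmersion r] (j : ι) (a : Γ(Y, preU r j)) :
    ∃ p : MvPolynomial ι k,
      a = MvPolynomial.eval₂
        ((preU r j).topIso.hom.hom.comp ((pull (chartLift r j)).comp (cst k (X j))))
        (fun i ↦ homRatio r j i) p := by
  obtain ⟨s, hs⟩ := pull_chartLift_surjective r j ((preU r j).topIso.inv a)
  obtain ⟨n, p, hp, rfl⟩ := Away.mk_surjective (grading ι k) (X_mem k j) s
  refine ⟨p, ?_⟩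
  have ha : a = (preU r j).topIso.hom (pull (chartLift r j) (Away.mk _ (X_mem k j) n p hp)) := by
    rw [hs, ← CategoryTheory.comp_apply, Iso.inv_hom_id]
    rfl
  rw [ha, awayMk_eq_eval₂, ← RingHom.comp_apply, ← RingHom.comp_apply, ← RingHom.comp_assoc,
    MvPolynomial.comp_eval₂Hom, MvPolynomial.coe_eval₂Hom]
  rfl

/-- **The constants of the chart lift are the structure constants.** For `c ∈ k`, the section
`(chart lift)^*(c) ∈ Γ(Y, r⁻¹D₊(xⱼ))` is the restriction of `(r ≫ (ℙ(ι) → Spec k))^*(c)`.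
[folklore] -/
theorem topIso_hom_pull_chartLift_cst (j : ι) (c : k) :
    (preU r j).topIso.hom (pull (chartLift r j) (cst k (X j) c)) =
      Y.presheaf.map (homOfLE (le_top : preU r j ≤ ⊤)).op (pull (r ≫ toSpec ι k) c) := by
  have h1 : pull (chartLift r j) (cst k (X j) c) =
      pull (chartLift r j ≫ Spec.map (CommRingCat.ofHom (cst k (X j)))) c := by
    rw [pull_SpecMap]
    rfl
  rw [h1, ← chartι_toSpec, ← Category.assoc, chartLift_chartι, Category.assoc, pull_comp,
    RingHom.comp_apply]
  generalize pull (r ≫ toSpec ι k) c = t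
  simp only [Scheme.Opens.ι_appTop, Scheme.Opens.topIso_hom]
  change (Y.presheaf.map _ ≫ Y.presheaf.map _).hom t = (Y.presheaf.map _).hom t
  rw [← Functor.map_comp]
  congr 3

end ChartLift

/-! ### Values of the ratios at `L`-points -/

section Points

variable {k : Type} [Field k] {X : SchemeOver k} {L : Type} [Field L] [Algebra k L]
  {N : ℕ} (ι : X ⟶ projectiveSpace N k)

/-- The generating-sections datum of the morphism `ι : X → ℙᴺ_k`: the opens `ι⁻¹D₊(xⱼ)` and the
ratios `ι^*(xᵢ/xⱼ)` (Hartshorne II Thm. 7.1 (a)). [cite: Hartshorne1977, II Thm. 7.1 (a)] -/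
abbrev affineChartData : GeneratingSections (Fin (N + 1)) X.left :=
  GeneratingSections.ofHom (k := k) (ι := Fin (N + 1)) ι.left

/-- The opens `ι⁻¹D₊(xⱼ)` are affine when `ι` is a closed immersion (`ι` is then affine).
[folklore] -/
theorem isAffineOpen_affineChartData_U [IsClosedImmersion ι.left] (j : Fin (N + 1)) :
    IsAffineOpen ((affineChartData ι).U j) := by
  haveI : @IsAffineHom X.left (Proj (grading (Fin (N + 1)) k)) ι.left :=
    (inferInstance : IsAffineHom ι.left)
  exact GeneratingSections.isAffineOpen_ofHom_U (k := k) (ι := Fin (N + 1)) ι.left j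

/-- `ι^*(xⱼ/xⱼ)` takes the value `1`. [folklore] -/
theorem eval_ratio_self (j : Fin (N + 1)) (Q : AlgPoints X L)
    (h : Q.pt ∈ (affineChartData ι).U j) :
    Q.eval _ h ((affineChartData ι).ratio j j) = 1 := by
  rw [(affineChartData ι).ratio_self, ← AlgPoints.evalRingHom_apply, map_one]

/-- `ι^*(xₗ/xⱼ)(Q) ≠ 0` iff `Q ∈ ι⁻¹D₊(xₗ)`, for `Q ∈ ι⁻¹D₊(xⱼ)(L)`. [folklore] -/
theorem eval_ratio_ne_zero_iff (j l : Fin (N + 1)) (Q : AlgPoints X L)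
    (h : Q.pt ∈ (affineChartData ι).U j) :
    Q.eval _ h ((affineChartData ι).ratio j l) ≠ 0 ↔ Q.pt ∈ (affineChartData ι).U l := by
  rw [AlgPoints.eval_ne_zero_iff_mem_basicOpen, (affineChartData ι).basicOpen_ratio]
  exact ⟨fun h' ↦ h'.2, fun h' ↦ ⟨h, h'⟩⟩

/-- The cocycle rule on values: `ι^*(xₗ/xⱼ)(Q) · ι^*(xᵢ/xₗ)(Q) = ι^*(xᵢ/xⱼ)(Q)` for
`Q ∈ (ι⁻¹D₊(xⱼ) ∩ ι⁻¹D₊(xₗ))(L)`. [folklore] -/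
theorem eval_ratio_mul_eval_ratio (j l i : Fin (N + 1)) (Q : AlgPoints X L)
    (hj : Q.pt ∈ (affineChartData ι).U j) (hl : Q.pt ∈ (affineChartData ι).U l) :
    Q.eval _ hj ((affineChartData ι).ratio j l) * Q.eval _ hl ((affineChartData ι).ratio l i) =
      Q.eval _ hj ((affineChartData ι).ratio j i) := by
  have key := congrArg (Q.evalRingHom ((affineChartData ι).U j ⊓ (affineChartData ι).U l) ⟨hj, hl⟩)
    ((affineChartData ι).ratio_mul_ratio j l i)
  rw [map_mul] at key
  simp only [AlgPoints.evalRingHom_apply] at key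
  rwa [AlgPoints.eval_map_homOfLE inf_le_left _ ⟨hj, hl⟩,
    AlgPoints.eval_map_homOfLE inf_le_right _ ⟨hj, hl⟩,
    AlgPoints.eval_map_homOfLE inf_le_left _ ⟨hj, hl⟩] at key

/-- The structure constants take the value `c` at every `L`-point: for `c ∈ k`, the section
`(ι ≫ (ℙᴺ → Spec k))^*(c)` restricted to `U ∋ Q` evaluates to `c ∈ L`. [folklore] -/
theorem eval_res_pull_toSpec (Q : AlgPoints X L) {U : X.left.Opens} (h : Q.pt ∈ U) (c : k) :
    Q.eval U h (X.left.presheaf.map (homOfLE (le_top : U ≤ ⊤)).op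
      (pull (ι.left ≫ toSpec (Fin (N + 1)) k) c)) = algebraMap k L c := by
  have hw : ι.left ≫ toSpec (Fin (N + 1)) k = X.hom := Over.w ι
  rw [hw]
  have h2 := AlgPoints.eval_appLE_top Q h le_top ((Scheme.ΓSpecIso (.of k)).inv c)
  rw [Iso.inv_hom_id_apply] at h2
  exact h2

/-- **Regular functions on `ι⁻¹D₊(xⱼ)` are polynomials in the ratios, on `L`-points** (the
hypothesis of `AlgPoints.exists_eval_eq_div` for the affine chart `ι⁻¹D₊(xⱼ)` of a closed
immersion `ι : X → ℙᴺ_k`): every `a ∈ Γ(X, ι⁻¹D₊(xⱼ))` satisfies `a(Q) = p((ι^*(xᵢ/xⱼ))(Q))ᵢ` for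
a polynomial `p` over `L`, at every `L`-point `Q` of `ι⁻¹D₊(xⱼ)`.
[cite: Hartshorne1977, II Prop. 7.2] -/
theorem exists_eval_eq_eval_ratio [IsClosedImmersion ι.left] (j : Fin (N + 1))
    (a : Γ(X.left, (affineChartData ι).U j)) :
    ∃ p : MvPolynomial (Fin (N + 1)) L, ∀ (Q : AlgPoints X L) (h : Q.pt ∈ (affineChartData ι).U j),
      Q.eval _ h a = MvPolynomial.eval (fun i ↦ Q.eval _ h ((affineChartData ι).ratio j i)) p := by
  haveI : @IsClosedImmersion X.left (Proj (grading (Fin (N + 1)) k)) ι.left := ‹_›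
  obtain ⟨p, hp⟩ := exists_eq_eval₂_homRatio (k := k) (ι := Fin (N + 1)) ι.left j a
  refine ⟨p.map (algebraMap k L), fun Q h ↦ ?_⟩
  rw [MvPolynomial.eval_map, hp]
  refine (MvPolynomial.eval₂_comp_left (Q.evalRingHom _ h) _ _ p).trans ?_
  congr 1
  ext c
  exact (congrArg (Q.eval _ h) (topIso_hom_pull_chartLift_cst (k := k) (ι := Fin (N + 1))
    ι.left j c)).trans (eval_res_pull_toSpec ι Q h c)

end Points

end GeneratingSections

end Literature.AlgebraicGeometry.Motives

/-! ## Part B. The maps `Gⱼ : M → ℂᴺ⁺¹` on an analytification and the Kähler form -/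

namespace Literature.AlgebraicGeometry.Motives

namespace AnalytificationKaehler

open Literature.NumberTheory.Transcendental Literature.Geometry.Kaehler Filter Topology
open scoped Manifold ContDiff

section Analytic

variable {k : Type} [Field k] [Algebra k ℂ] {X : SchemeOver k}
  {M : Type*} {E : Type*} [NormedAddCommGroup E] [NormedSpace ℂ E]
  {N : ℕ} (ι : X ⟶ projectiveSpace N k) (φ : M → ComplexPoints X)

/-- The open subset `Mⱼ = φ⁻¹(ι⁻¹D₊(xⱼ)(ℂ))` of `M` over the `j`-th affine chart of `X ⊆ ℙᴺ`.
[folklore] -/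
def chartDom (j : Fin (N + 1)) : Set M :=
  φ ⁻¹' {P | P.pt ∈ (GeneratingSections.affineChartData ι).U j}

/-- The affine coordinates on the `j`-th chart read on `M`: `m ↦ (ι^*(xᵢ/xⱼ))(φ m)` for
`i = 0, …, N` (total functions, meaningful on `Mⱼ`). These are the components of Voisin's
`σⱼ = (z₁, …, 1, …, z_N)` (§3.3.2) composed with the embedding. [cite: VoisinHodgeI2002, §3.3.2] -/
def coordFun (j : Fin (N + 1)) (m : M) : Fin (N + 1) → ℂ := fun i ↦
  AlgPoints.evalOrZero ((GeneratingSections.affineChartData ι).U j)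
    ((GeneratingSections.affineChartData ι).ratio j i) (φ m)

/-- The affine coordinates on the `j`-th chart as a map `Gⱼ : M → ℂᴺ⁺¹` into Euclidean space (a
holomorphic lift of `M → ℙᴺ(ℂ)` over `Mⱼ`). [cite: VoisinHodgeI2002, §3.3.2] -/
def coordVec (j : Fin (N + 1)) (m : M) : EuclideanSpace ℂ (Fin (N + 1)) :=
  (EuclideanSpace.equiv (Fin (N + 1)) ℂ).symm (coordFun ι φ j m)

/-- Components of `coordVec`. [folklore] -/
@[simp]
theorem coordVec_apply (j : Fin (N + 1)) (m : M) (i : Fin (N + 1)) :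
    coordVec ι φ j m i = coordFun ι φ j m i :=
  rfl

/-- `coordFun` is `coordVec` read through the coordinate isomorphism. [folklore] -/
theorem coordFun_eq_equiv_coordVec (j : Fin (N + 1)) :
    coordFun ι φ j = (EuclideanSpace.equiv (Fin (N + 1)) ℂ) ∘ coordVec ι φ j := by
  funext m
  exact ((EuclideanSpace.equiv (Fin (N + 1)) ℂ).apply_symm_apply _).symm

variable {ι φ}

/-- Membership in `Mⱼ` means `φ(m) ∈ ι⁻¹D₊(xⱼ)` (definitional). [folklore] -/
theorem pt_mem_of_mem_chartDom {j : Fin (N + 1)} {m : M} (hm : m ∈ chartDom ι φ j) :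
    (φ m).pt ∈ (GeneratingSections.affineChartData ι).U j :=
  hm

/-- On `Mⱼ` the `j`-th coordinate is `1` (`xⱼ/xⱼ = 1`). [folklore] -/
theorem coordFun_self {j : Fin (N + 1)} {m : M} (hm : m ∈ chartDom ι φ j) :
    coordFun ι φ j m j = 1 := by
  simp only [coordFun, AlgPoints.evalOrZero_of_mem _ (pt_mem_of_mem_chartDom hm)]
  exact GeneratingSections.eval_ratio_self ι j (φ m) hm

/-- On `Mⱼ`, `Gⱼ(m) ≠ 0`. [folklore] -/
theorem coordVec_ne_zero {j : Fin (N + 1)} {m : M} (hm : m ∈ chartDom ι φ j) :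
    coordVec ι φ j m ≠ 0 := by
  intro h
  have := congrArg (fun w : EuclideanSpace ℂ (Fin (N + 1)) ↦ w j) h
  simp only [coordVec_apply, coordFun_self hm] at this
  exact one_ne_zero this

/-- On `Mⱼ`, the `l`-th coordinate vanishes exactly off `M_l`. [folklore] -/
theorem coordFun_ne_zero_iff {j l : Fin (N + 1)} {m : M} (hm : m ∈ chartDom ι φ j) :
    coordFun ι φ j m l ≠ 0 ↔ m ∈ chartDom ι φ l := by
  simp only [coordFun, AlgPoints.evalOrZero_of_mem _ (pt_mem_of_mem_chartDom hm)]
  exact GeneratingSections.eval_ratio_ne_zero_iff ι j l (φ m) hm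

/-- **The cocycle rule on `M`**: on `Mⱼ ∩ M_l`, `G_l = (ι^*(x_l/xⱼ) ∘ φ)⁻¹ · Gⱼ` (Voisin (2002),
§3.3.2: `σⱼ = (Zᵢ/Zⱼ) σᵢ` on `Uᵢ ∩ Uⱼ`). [cite: VoisinHodgeI2002, §3.3.2] -/
theorem coordVec_eq_smul {j l : Fin (N + 1)} {m : M} (hj : m ∈ chartDom ι φ j)
    (hl : m ∈ chartDom ι φ l) :
    coordVec ι φ l m = (coordFun ι φ j m l)⁻¹ • coordVec ι φ j m := by
  have hne : coordFun ι φ j m l ≠ 0 := (coordFun_ne_zero_iff hj).2 hl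
  have key : ∀ i, coordFun ι φ j m l * coordFun ι φ l m i = coordFun ι φ j m i := by
    intro i
    simp only [coordFun, AlgPoints.evalOrZero_of_mem _ (pt_mem_of_mem_chartDom hj),
      AlgPoints.evalOrZero_of_mem _ (pt_mem_of_mem_chartDom hl)]
    exact GeneratingSections.eval_ratio_mul_eval_ratio ι j l i (φ m) hj hl
  ext i
  simp only [coordVec_apply, PiLp.smul_apply, smul_eq_mul]
  rw [← key i, ← mul_assoc, inv_mul_cancel₀ hne, one_mul]

/-- Every point of `M` lies in some `Mⱼ` (the `ι⁻¹D₊(xⱼ)` cover `X`). [folklore] -/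
theorem exists_mem_chartDom (m : M) : ∃ j, m ∈ chartDom ι φ j := by
  have h : (φ m).pt ∈ (⊤ : X.left.Opens) := trivial
  rw [← (GeneratingSections.affineChartData ι).iSup_U, Opens.mem_iSup] at h
  exact h

/-- A chosen chart index at each point of `M`. [folklore] -/
def chartIndex (m : M) : Fin (N + 1) := Classical.choose (exists_mem_chartDom (ι := ι) (φ := φ) m)

/-- The chosen chart contains the point. [folklore] -/
theorem mem_chartDom_chartIndex (m : M) : m ∈ chartDom ι φ (chartIndex (ι := ι) (φ := φ) m) :=
  Classical.choose_spec (exists_mem_chartDom (ι := ι) (φ := φ) m)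

section Holomorphic

variable [FiniteDimensional ℂ E] [TopologicalSpace M] [ChartedSpace E M] {d : ℕ}
  (hφ : IsAnalytification E X d φ)
include hφ

/-- `Mⱼ` is open. [folklore] -/
theorem isOpen_chartDom (j : Fin (N + 1)) : IsOpen (chartDom ι φ j) :=
  hφ.isOpen_preimage _

variable [IsClosedImmersion ι.left]

/-- **The affine coordinates are holomorphic on `Mⱼ`** (regular functions on the affine open
`ι⁻¹D₊(xⱼ)` are holomorphic on an analytification). [cite: SerreGAGA1956, §2 n°5 Lemme 1] -/
theorem mdifferentiableOn_coordFun (j i : Fin (N + 1)) :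
    MDifferentiableOn 𝓘(ℂ, E) 𝓘(ℂ, ℂ) (fun m ↦ coordFun ι φ j m i) (chartDom ι φ j) :=
  hφ.mdifferentiableOn_evalOrZero ⟨_, GeneratingSections.isAffineOpen_affineChartData_U ι j⟩ _

/-- `Gⱼ` is holomorphic on `Mⱼ`. [cite: SerreGAGA1956, §2 n°5 Lemme 1] -/
theorem mdifferentiableOn_coordVec (j : Fin (N + 1)) :
    MDifferentiableOn 𝓘(ℂ, E) 𝓘(ℂ, EuclideanSpace ℂ (Fin (N + 1))) (coordVec ι φ j)
      (chartDom ι φ j) := by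
  have h1 : MDifferentiableOn 𝓘(ℂ, E) 𝓘(ℂ, Fin (N + 1) → ℂ) (coordFun ι φ j) (chartDom ι φ j) :=
    fun m hm ↦ Literature.Geometry.Kaehler.mdifferentiableWithinAt_pi_space.2
      fun i ↦ mdifferentiableOn_coordFun hφ j i m hm
  have h2 : coordVec ι φ j = (EuclideanSpace.equiv (Fin (N + 1)) ℂ).symm ∘ coordFun ι φ j := rfl
  have h3 : MDifferentiable 𝓘(ℂ, Fin (N + 1) → ℂ) 𝓘(ℂ, EuclideanSpace ℂ (Fin (N + 1)))
      ((EuclideanSpace.equiv (Fin (N + 1)) ℂ).symm) :=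
    fun x ↦ (EuclideanSpace.equiv (Fin (N + 1)) ℂ).symm.hasMFDerivAt.mdifferentiableAt
  rw [h2]
  exact h3.comp_mdifferentiableOn h1

/-- `Gⱼ` is holomorphic at the points of `Mⱼ`. [cite: SerreGAGA1956, §2 n°5 Lemme 1] -/
theorem mdifferentiableAt_coordVec {j : Fin (N + 1)} {m : M} (hm : m ∈ chartDom ι φ j) :
    MDifferentiableAt 𝓘(ℂ, E) 𝓘(ℂ, EuclideanSpace ℂ (Fin (N + 1))) (coordVec ι φ j) m :=
  (mdifferentiableOn_coordVec hφ j).mdifferentiableAt ((isOpen_chartDom hφ j).mem_nhds hm)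

/-- A coordinate is holomorphic at the points of `Mⱼ`. [cite: SerreGAGA1956, §2 n°5 Lemme 1] -/
theorem mdifferentiableAt_coordFun {j : Fin (N + 1)} {m : M} (hm : m ∈ chartDom ι φ j)
    (i : Fin (N + 1)) :
    MDifferentiableAt 𝓘(ℂ, E) 𝓘(ℂ, ℂ) (fun x ↦ coordFun ι φ j x i) m :=
  (mdifferentiableOn_coordFun hφ j i).mdifferentiableAt ((isOpen_chartDom hφ j).mem_nhds hm)

/-- **The local Fubini–Study forms glue**: on `Mⱼ ∩ M_l` the pulled-back forms `θⱼ = Gⱼ^*β₀` and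
`θ_l` coincide, since `G_l = f · Gⱼ` near `m` with `f = (ι^*(x_l/xⱼ) ∘ φ)⁻¹` holomorphic and
non-zero (Voisin (2002), §3.3.1: the `ωᵢ` «coincide on `Uᵢ ∩ Uⱼ`»). [cite: VoisinHodgeI2002, §3.3.1] -/
theorem fsPullback_coordVec_eq {j l : Fin (N + 1)} {m : M}
    (hj : m ∈ chartDom ι φ j) (hl : m ∈ chartDom ι φ l) :
    fsPullback E (coordVec ι φ l) m = fsPullback E (coordVec ι φ j) m := by
  -- `G_l = f • G_j` near `m`
  have hev : coordVec ι φ l =ᶠ[𝓝 m] fun x ↦ (coordFun ι φ j x l)⁻¹ • coordVec ι φ j x := by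
    filter_upwards [((isOpen_chartDom hφ j).inter (isOpen_chartDom hφ l)).mem_nhds ⟨hj, hl⟩]
      with x hx
    exact coordVec_eq_smul hx.1 hx.2
  rw [fsPullback_congr_of_eventuallyEq hev]
  have hne : coordFun ι φ j m l ≠ 0 := (coordFun_ne_zero_iff hj).2 hl
  have hf : MDifferentiableAt 𝓘(ℂ, E) 𝓘(ℂ, ℂ) (fun x ↦ (coordFun ι φ j x l)⁻¹) m := by
    have h1 : MDifferentiableAt 𝓘(ℂ, ℂ) 𝓘(ℂ, ℂ) (fun z : ℂ ↦ z⁻¹) (coordFun ι φ j m l) :=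
      mdifferentiableAt_iff_differentiableAt.2 (differentiableAt_inv hne)
    exact h1.comp m (mdifferentiableAt_coordFun hφ hj l)
  exact fsPullback_smul hf (mdifferentiableAt_coordVec hφ hj) (inv_ne_zero hne)
    (coordVec_ne_zero hj)

end Holomorphic

/-! ### The Kähler form -/

variable (E) [TopologicalSpace M] [ChartedSpace E M] (ι φ) in
/-- **The candidate Kähler form**: at `m`, the pull-back `θ_{j(m)}(m) = (G_{j(m)}^*β₀)(m)` of the
Fubini–Study form along the affine coordinates of a chosen chart containing `m` (by
`fsPullback_coordVec_eq` the choice is immaterial). This is the restriction to `X^an` of the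
Fubini–Study form of `ℙᴺ(ℂ)` (Voisin (2002), §3.3.2), built without the manifold `ℙᴺ(ℂ)`.
[cite: VoisinHodgeI2002, §3.3.2] -/
def fubiniStudyPullbackForm : MForm 𝓘(ℝ, E) M ℝ 2 := fun m ↦
  fsPullback E (coordVec ι φ (chartIndex (ι := ι) (φ := φ) m)) m

section Form

variable [FiniteDimensional ℂ E] [TopologicalSpace M] [ChartedSpace E M] {d : ℕ}
  (hφ : IsAnalytification E X d φ) [IsClosedImmersion ι.left]
include hφ

/-- Near a point of `Mⱼ`, the candidate form is the pulled-back form of the `j`-th chart.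
[cite: VoisinHodgeI2002, §3.3.1] -/
theorem fubiniStudyPullbackForm_eventuallyEq {j : Fin (N + 1)} {m : M} (hm : m ∈ chartDom ι φ j) :
    ∀ᶠ x in 𝓝 m, fubiniStudyPullbackForm E ι φ x = fsPullback E (coordVec ι φ j) x := by
  filter_upwards [(isOpen_chartDom hφ j).mem_nhds hm] with x hx
  exact fsPullback_coordVec_eq hφ hx (mem_chartDom_chartIndex x)

/-- The candidate form is smooth. [cite: VoisinHodgeI2002, §3.1.3] -/
theorem isSmoothForm_fubiniStudyPullbackForm [IsManifold 𝓘(ℂ, E) ω M] [IsManifold 𝓘(ℝ, E) ∞ M] :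
    IsSmoothForm (fubiniStudyPullbackForm E ι φ) := by
  intro m
  obtain ⟨j, hm⟩ := exists_mem_chartDom (ι := ι) (φ := φ) m
  exact (smoothAt_fsPullback (mdifferentiableOn_coordVec hφ j) (isOpen_chartDom hφ j) hm
    (coordVec_ne_zero hm)).congr_of_eventuallyEq
      ((fubiniStudyPullbackForm_eventuallyEq hφ hm).mono fun _ h ↦ h.symm)

/-- The candidate form is closed. [cite: VoisinHodgeI2002, §3.1.3] -/
theorem isClosedForm_fubiniStudyPullbackForm [IsManifold 𝓘(ℂ, E) ω M] [IsManifold 𝓘(ℝ, E) ∞ M] :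
    IsClosedForm (fubiniStudyPullbackForm E ι φ) := by
  funext m
  obtain ⟨j, hm⟩ := exists_mem_chartDom (ι := ι) (φ := φ) m
  rw [mextDeriv_congr_of_eventuallyEq (fubiniStudyPullbackForm_eventuallyEq hφ hm)]
  exact mextDeriv_fsPullback (mdifferentiableOn_coordVec hφ j) (isOpen_chartDom hφ j) hm
    (coordVec_ne_zero hm)

/-- The candidate form is of type `(1,1)`. [cite: VoisinHodgeI2002, §3.3.1] -/
theorem fubiniStudyPullbackForm_tangentJ (m : M) (v w : TangentSpace 𝓘(ℝ, E) m) :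
    fubiniStudyPullbackForm E ι φ m ![tangentJ E m v, tangentJ E m w] =
      fubiniStudyPullbackForm E ι φ m ![v, w] :=
  fsPullback_tangentJ (mdifferentiableAt_coordVec hφ (mem_chartDom_chartIndex m))
    (coordVec_ne_zero (mem_chartDom_chartIndex m)) v w

/-- The candidate form is semi-positive. [cite: VoisinHodgeI2002, §3.3.2 Lemma 3.16] -/
theorem fubiniStudyPullbackForm_self_tangentJ_nonneg (m : M) (v : TangentSpace 𝓘(ℝ, E) m) :
    0 ≤ fubiniStudyPullbackForm E ι φ m ![v, tangentJ E m v] :=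
  fsPullback_self_tangentJ_nonneg (mdifferentiableAt_coordVec hφ (mem_chartDom_chartIndex m))
    (coordVec_ne_zero (mem_chartDom_chartIndex m)) v

end Form

/-! ### Immersivity: `dGⱼ(m) v = 0 ⇒ v = 0` -/

section Immersion

variable [FiniteDimensional ℂ E] [TopologicalSpace M] [ChartedSpace E M] {d : ℕ}
  (hφ : IsAnalytification E X d φ) [IsClosedImmersion ι.left] [IsManifold 𝓘(ℂ, E) ω M]
  [SmoothOfRelativeDimension d X.hom]
include hφ

/-- **The affine coordinates immerse `X^an`**: if all the differentials `d(ι^*(xᵢ/xⱼ) ∘ φ)_m`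
(`i = 0, …, N`) kill a tangent vector `v` at a point `m ∈ Mⱼ`, then `v = 0`. `X` being smooth of
relative dimension `d` over `k`, the point `φ(m)` has an affine neighbourhood `V` with a standard
smooth presentation `Γ(X, V) = k[Xᵢ]/(fⱼ)`; its free coordinates `x_f ∘ φ` are injective near `m`
(uniqueness in the implicit function theorem, `exists_isOpen_injOn_of_det_ne_zero`), hence form a
holomorphic chart of `M` at `m` by the Clements–Osgood theorem
(`Literature.Analysis.Complex.SCV.bijective_fderiv_of_injOn`) — this is the argument of the tree's
`IsAnalytification.mdifferentiable_comp_map_holds`; and each `x_f` is near `φ(m)` a quotient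
`pa/pg^μ` of polynomials in the `ι^*(xᵢ/xⱼ)` (`AlgPoints.exists_eval_eq_div`, the `ι^*(xᵢ/xⱼ)`
generating `Γ(X, ι⁻¹D₊(xⱼ))`), so `d(x_f ∘ φ)_m` factors through the `d(ι^*(xᵢ/xⱼ) ∘ φ)_m`.
(Serre, GAGA §2 n°6 Prop. 3 Cor. 2 and §1 n°4: at a simple point the algebraic charts make `X^h` a
submanifold of the chart of the ambient space.) [cite: SerreGAGA1956, §2 n°6 Prop. 3 Cor. 2] -/
theorem eq_zero_of_mfderiv_coordFun_apply_eq_zero {j : Fin (N + 1)} {m : M}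
    (hm : m ∈ chartDom ι φ j) {v : TangentSpace 𝓘(ℂ, E) m}
    (hv : ∀ i, mfderiv 𝓘(ℂ, E) 𝓘(ℂ, ℂ) (fun x ↦ coordFun ι φ j x i) m v = 0) : v = 0 := by
  classical
  haveI : IsManifold 𝓘(ℂ, E) 1 M := inferInstance
  haveI : CompleteSpace E := FiniteDimensional.complete ℂ E
  set Q : ComplexPoints X := φ m with hQdef
  have hQj : Q.pt ∈ (GeneratingSections.affineChartData ι).U j := hm
  /- Step 1: a standard smooth presentation `Γ(X, V) = k[Xᵢ]/(fⱼ)` on an affine open `V ∋ Q.pt`. -/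
  obtain ⟨U', hU', V, hV, hyV, eVU, hstd⟩ :=
    SmoothOfRelativeDimension.exists_isStandardSmoothOfRelativeDimension (n := d) (f := X.hom)
      Q.pt
  obtain rfl : U' = ⊤ := by
    refine eq_top_iff.2 fun p _ ↦ ?_
    have hy : X.hom.base Q.pt ∈ U' := eVU hyV
    rwa [Subsingleton.elim p (X.hom.base Q.pt)]
  letI alg : Algebra Γ(Spec (.of k), ⊤) Γ(X.left, V) := (X.hom.appLE ⊤ V eVU).hom.toAlgebra
  have halg : algebraMap Γ(Spec (.of k), ⊤) Γ(X.left, V) = (X.hom.appLE ⊤ V eVU).hom := rfl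
  obtain ⟨ι', σ, _, _, P, hPdim⟩ := hstd.toAlgebra.out
  cases nonempty_fintype ι'
  cases nonempty_fintype σ
  set F : σ → MvPolynomial ι' ℂ := fun j' ↦
    MvPolynomial.map ((algebraMap k ℂ).comp (Scheme.ΓSpecIso (.of k)).hom.hom) (P.relation j')
    with hF
  set xf : ι' → ComplexPoints X → ℂ := fun i ↦ AlgPoints.evalOrZero V (P.val i) with hxf
  have hQV : Q.pt ∈ V := hyV
  /- Step 2: the coordinates `x : V(ℂ) → ℂ^ι'` are injective, land in the zero set of the `F j'`,
  and the Jacobian in the distinguished variables does not vanish at `x(Q)`. -/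
  have hrel : ∀ R : ComplexPoints X, R.pt ∈ V → ∀ j', MvPolynomial.eval (fun i ↦ xf i R) (F j') = 0 := by
    intro R hR j'
    have := AlgPoints.eval_map_relation eVU halg P.toPresentation R hR j'
    simp only [hxf, AlgPoints.evalOrZero_of_mem _ hR]
    exact this
  have hinjV : ∀ R R' : ComplexPoints X, R.pt ∈ V → R'.pt ∈ V →
      (∀ i, xf i R = xf i R') → R = R' := by
    intro R R' hR hR' hx
    refine AlgPoints.ext_of_forall_eval_val_eq hV eVU halg P.toGenerators hR hR' fun i ↦ ?_
    have := hx i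
    simp only [hxf] at this
    rwa [AlgPoints.evalOrZero_of_mem _ hR, AlgPoints.evalOrZero_of_mem _ hR'] at this
  have hdet : (Matrix.of fun i j' : σ ↦ MvPolynomial.eval (fun l ↦ xf l Q)
      (MvPolynomial.pderiv (P.map i) (F j'))).det ≠ 0 := by
    have := AlgPoints.det_eval_pderiv_relation_ne_zero eVU halg P Q hQV
    simp only [hxf, AlgPoints.evalOrZero_of_mem _ hQV]
    exact this
  /- Step 3: the free coordinates `xᵢ ∘ φ`, `i ∉ c(σ)`, are injective on a neighbourhood `N₁` of
  `m`. -/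
  obtain ⟨W, hWo, hcW, hWinj⟩ :=
    exists_isOpen_injOn_of_det_ne_zero P.map P.map_inj F (fun l ↦ xf l Q) hdet
  set N₁ : Set M := φ ⁻¹' {R | R.pt ∈ V} ∩ (fun m'' ↦ fun l ↦ xf l (φ m'')) ⁻¹' W with hN₁
  have hN₁o : IsOpen N₁ := by
    refine ContinuousOn.isOpen_inter_preimage ?_ (hφ.isOpen_preimage V) hWo
    refine continuousOn_pi.2 fun l ↦ ?_
    exact (AlgPoints.continuousOn_evalOrZero V (P.val l)).comp
      hφ.isHomeomorph.continuous.continuousOn fun m'' hm'' ↦ hm''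
  have hmN₁ : m ∈ N₁ := ⟨hQV, hcW⟩
  have hinjN₁ : ∀ m₁ ∈ N₁, ∀ m₂ ∈ N₁,
      (∀ i : {i : ι' // i ∉ Set.range P.map}, xf i.1 (φ m₁) = xf i.1 (φ m₂)) → m₁ = m₂ := by
    intro m₁ hm₁ m₂ hm₂ hfree
    apply hφ.isHomeomorph.injective
    refine hinjV _ _ hm₁.1 hm₂.1 fun i ↦ ?_
    have key := hWinj _ hm₁.2 _ hm₂.2 (fun i hi ↦ hfree ⟨i, hi⟩)
      (fun j' ↦ by rw [hrel _ hm₁.1, hrel _ hm₂.1])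
    exact congrFun key i
  /- Step 4 (Clements–Osgood): in the chart `χ` of `M` at `m`, `T = x_free ∘ φ ∘ χ⁻¹` is an
  injective holomorphic map between open subsets of `d`-dimensional spaces, so its differential at
  `χ m` is bijective. -/
  set χ : OpenPartialHomeomorph M E := chartAt E m with hχ
  set O : Set E := χ.target ∩ χ.symm ⁻¹' N₁ with hO
  have hOo : IsOpen O := χ.isOpen_inter_preimage_symm hN₁o
  set T : E → ({i : ι' // i ∉ Set.range P.map} → ℂ) :=
    fun z i ↦ xf i.1 (φ (χ.symm z)) with hT
  have hz₀ : χ m ∈ O :=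
    ⟨χ.map_source (mem_chart_source E m), by
      show χ.symm (χ m) ∈ N₁
      rw [χ.left_inv (mem_chart_source E m)]
      exact hmN₁⟩
  have hyM : ∀ i, MDifferentiableOn 𝓘(ℂ, E) 𝓘(ℂ, ℂ) (fun m'' ↦ xf i (φ m''))
      (φ ⁻¹' {R | R.pt ∈ V}) :=
    fun i ↦ hφ.mdifferentiableOn_evalOrZero ⟨V, hV⟩ (P.val i)
  have hTd : DifferentiableOn ℂ T O := by
    intro z hz
    suffices hd : DifferentiableAt ℂ T z from hd.differentiableWithinAt
    refine differentiableAt_pi.2 fun i ↦ ?_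
    have h1 : MDifferentiableAt 𝓘(ℂ, E) 𝓘(ℂ, ℂ) (fun m'' ↦ xf i.1 (φ m'')) (χ.symm z) :=
      (hyM i.1).mdifferentiableAt ((hφ.isOpen_preimage _).mem_nhds hz.2.1)
    have h2 : MDifferentiableAt 𝓘(ℂ, E) 𝓘(ℂ, E) χ.symm z :=
      mdifferentiableAt_atlas_symm (chart_mem_atlas E m) hz.1
    exact mdifferentiableAt_iff_differentiableAt.1 (h1.comp z h2)
  have hTinj : Set.InjOn T O := by
    intro z hz z' hz' hzz'
    have : χ.symm z = χ.symm z' := hinjN₁ _ hz.2 _ hz'.2 fun i ↦ congrFun hzz' i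
    rw [← χ.right_inv hz.1, ← χ.right_inv hz'.1, this]
  have hcard : Fintype.card {i : ι' // i ∉ Set.range P.map} = d := by
    rw [Fintype.card_subtype_compl]
    change Fintype.card ι' - Fintype.card (Set.range P.map) = d
    rw [Set.card_range_of_injective P.map_inj, ← hPdim, Algebra.Presentation.dimension,
      Nat.card_eq_fintype_card, Nat.card_eq_fintype_card]
  have hdim : Module.finrank ℂ E = Module.finrank ℂ ({i : ι' // i ∉ Set.range P.map} → ℂ) := by
    rw [hφ.finrank_eq, Module.finrank_fintype_fun_eq_card, hcard]
  have hbij := Literature.Analysis.Complex.SCV.bijective_fderiv_of_injOn hdim hTd hOo hTinj hz₀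
  /- Step 5 (new): each free coordinate `xᵢ ∘ φ` is, near `m`, a rational function of the affine
  coordinates `ι^*(x_l/xⱼ) ∘ φ` of the `j`-th chart, so its differential at `m` kills `v`. -/
  have hcoordQ : (fun i ↦ AlgPoints.evalOrZero ((GeneratingSections.affineChartData ι).U j)
      ((GeneratingSections.affineChartData ι).ratio j i) Q) = coordFun ι φ j m := rfl
  have hmf : mfderiv 𝓘(ℂ, E) 𝓘(ℂ, Fin (N + 1) → ℂ) (coordFun ι φ j) m v = 0 := by
    have hcF : MDifferentiableAt 𝓘(ℂ, E) 𝓘(ℂ, Fin (N + 1) → ℂ) (coordFun ι φ j) m := by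
      rw [← mdifferentiableWithinAt_univ]
      refine Literature.Geometry.Kaehler.mdifferentiableWithinAt_pi_space.2 fun i ↦ ?_
      rw [mdifferentiableWithinAt_univ]
      exact mdifferentiableAt_coordFun hφ hm i
    funext i
    have hcomp := mfderiv_comp m
      ((ContinuousLinearMap.proj (R := ℂ) (φ := fun _ : Fin (N + 1) ↦ ℂ) i).hasMFDerivAt
        (x := coordFun ι φ j m)).mdifferentiableAt hcF
    rw [ContinuousLinearMap.mfderiv_eq] at hcomp
    have h1 : mfderiv 𝓘(ℂ, E) 𝓘(ℂ, ℂ) (fun x ↦ coordFun ι φ j x i) m v =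
        (ContinuousLinearMap.proj (R := ℂ) (φ := fun _ : Fin (N + 1) ↦ ℂ) i)
          (mfderiv 𝓘(ℂ, E) 𝓘(ℂ, Fin (N + 1) → ℂ) (coordFun ι φ j) m v) :=
      congrArg (fun L ↦ L v) hcomp
    rw [hv i] at h1
    exact h1.symm
  have hfree : ∀ i : {i : ι' // i ∉ Set.range P.map},
      mfderiv 𝓘(ℂ, E) 𝓘(ℂ, ℂ) (fun x ↦ xf i.1 (φ x)) m v = 0 := by
    intro i
    obtain ⟨pa, pg, μ, hpg0, hall⟩ := AlgPoints.exists_eval_eq_div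
      (GeneratingSections.isAffineOpen_affineChartData_U ι j)
      (fun i' ↦ (GeneratingSections.affineChartData ι).ratio j i')
      (GeneratingSections.exists_eval_eq_eval_ratio ι j) V (P.val i.1) (P := Q) hQV hQj
    rw [hcoordQ] at hpg0
    -- the rational function `R = pa / pg ^ μ` of the coordinates
    set R : (Fin (N + 1) → ℂ) → ℂ :=
      fun c ↦ MvPolynomial.eval c pa * (MvPolynomial.eval c pg ^ μ)⁻¹ with hR
    have hpa : DifferentiableAt ℂ (fun c : Fin (N + 1) → ℂ ↦ MvPolynomial.eval c pa)
        (coordFun ι φ j m) :=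
      (MvPolynomial.hasStrictFDerivAt_eval pa _).hasFDerivAt.differentiableAt
    have hpg : DifferentiableAt ℂ (fun c : Fin (N + 1) → ℂ ↦ MvPolynomial.eval c pg)
        (coordFun ι φ j m) :=
      (MvPolynomial.hasStrictFDerivAt_eval pg _).hasFDerivAt.differentiableAt
    have hRd : DifferentiableAt ℂ R (coordFun ι φ j m) :=
      hpa.fun_mul ((hpg.fun_pow μ).fun_inv (pow_ne_zero μ hpg0))
    -- `xᵢ ∘ φ = R ∘ coordFun` near `m`
    have hloc : (fun x ↦ xf i.1 (φ x)) =ᶠ[𝓝 m] (R ∘ coordFun ι φ j) := by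
      have hcont : ContinuousOn (coordFun ι φ j) (chartDom ι φ j) := by
        refine continuousOn_pi.2 fun i' ↦ ?_
        exact (AlgPoints.continuousOn_evalOrZero _ _).comp
          hφ.isHomeomorph.continuous.continuousOn fun m'' hm'' ↦ hm''
      have hSo : IsOpen (chartDom ι φ j ∩
          coordFun ι φ j ⁻¹' {c | MvPolynomial.eval c pg ≠ 0}) := by
        refine hcont.isOpen_inter_preimage (isOpen_chartDom hφ j) ?_
        exact isOpen_ne_fun (MvPolynomial.continuous_eval pg) continuous_const
      filter_upwards [hSo.mem_nhds ⟨hm, hpg0⟩] with x hx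
      obtain ⟨hxV, hval⟩ := hall (φ x) hx.1 hx.2
      show AlgPoints.evalOrZero V (P.val i.1) (φ x) =
        MvPolynomial.eval (coordFun ι φ j x) pa * (MvPolynomial.eval (coordFun ι φ j x) pg ^ μ)⁻¹
      rw [AlgPoints.evalOrZero_of_mem _ hxV, ← div_eq_mul_inv]
      exact hval
    rw [hloc.mfderiv_eq]
    have hcF : MDifferentiableAt 𝓘(ℂ, E) 𝓘(ℂ, Fin (N + 1) → ℂ) (coordFun ι φ j) m := by
      rw [← mdifferentiableWithinAt_univ]
      refine Literature.Geometry.Kaehler.mdifferentiableWithinAt_pi_space.2 fun i ↦ ?_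
      rw [mdifferentiableWithinAt_univ]
      exact mdifferentiableAt_coordFun hφ hm i
    rw [mfderiv_comp m (mdifferentiableAt_iff_differentiableAt.2 hRd) hcF]
    change (mfderiv 𝓘(ℂ, Fin (N + 1) → ℂ) 𝓘(ℂ, ℂ) R (coordFun ι φ j m))
      (mfderiv 𝓘(ℂ, E) 𝓘(ℂ, Fin (N + 1) → ℂ) (coordFun ι φ j) m v) = 0
    rw [hmf, map_zero]
  /- Step 6: `x_free ∘ φ = T ∘ χ` near `m`, so `DT(χ m) (dχ_m v) = d(x_free ∘ φ)_m v = 0`, hence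
  `dχ_m v = 0`, i.e. `v = 0`. -/
  set A₀ : M → ({i : ι' // i ∉ Set.range P.map} → ℂ) := fun x i ↦ xf i.1 (φ x) with hA₀
  have hA₀d : MDifferentiableAt 𝓘(ℂ, E) 𝓘(ℂ, {i : ι' // i ∉ Set.range P.map} → ℂ) A₀ m := by
    rw [← mdifferentiableWithinAt_univ]
    refine Literature.Geometry.Kaehler.mdifferentiableWithinAt_pi_space.2 fun i ↦ ?_
    rw [mdifferentiableWithinAt_univ]
    exact (hyM i.1).mdifferentiableAt ((hφ.isOpen_preimage _).mem_nhds hQV)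
  have hA₀v : mfderiv 𝓘(ℂ, E) 𝓘(ℂ, {i : ι' // i ∉ Set.range P.map} → ℂ) A₀ m v = 0 := by
    funext i
    have hcomp := mfderiv_comp m
      ((ContinuousLinearMap.proj (R := ℂ) (φ := fun _ : {i : ι' // i ∉ Set.range P.map} ↦ ℂ)
        i).hasMFDerivAt (x := A₀ m)).mdifferentiableAt hA₀d
    rw [ContinuousLinearMap.mfderiv_eq] at hcomp
    have h1 : mfderiv 𝓘(ℂ, E) 𝓘(ℂ, ℂ) (fun x ↦ xf i.1 (φ x)) m v =
        (ContinuousLinearMap.proj (R := ℂ) (φ := fun _ : {i : ι' // i ∉ Set.range P.map} ↦ ℂ) i)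
          (mfderiv 𝓘(ℂ, E) 𝓘(ℂ, {i : ι' // i ∉ Set.range P.map} → ℂ) A₀ m v) :=
      congrArg (fun L ↦ L v) hcomp
    rw [hfree i] at h1
    exact h1.symm
  have hχd : MDifferentiableAt 𝓘(ℂ, E) 𝓘(ℂ, E) χ m :=
    mdifferentiableAt_atlas (chart_mem_atlas E m) (mem_chart_source E m)
  have hTmd : MDifferentiableAt 𝓘(ℂ, E) 𝓘(ℂ, {i : ι' // i ∉ Set.range P.map} → ℂ) T (χ m) :=
    mdifferentiableAt_iff_differentiableAt.2 (hTd.differentiableAt (hOo.mem_nhds hz₀))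
  have hTA : A₀ =ᶠ[𝓝 m] (T ∘ χ) := by
    filter_upwards [χ.open_source.mem_nhds (mem_chart_source E m)] with x hx
    simp only [hA₀, hT, Function.comp_apply, χ.left_inv hx]
  have h2 : mfderiv 𝓘(ℂ, E) 𝓘(ℂ, {i : ι' // i ∉ Set.range P.map} → ℂ) A₀ m =
      mfderiv 𝓘(ℂ, E) 𝓘(ℂ, {i : ι' // i ∉ Set.range P.map} → ℂ) (T ∘ χ) m := hTA.mfderiv_eq
  have h3 := mfderiv_comp m hTmd hχd
  have h4 : mfderiv 𝓘(ℂ, E) 𝓘(ℂ, {i : ι' // i ∉ Set.range P.map} → ℂ) T (χ m) = fderiv ℂ T (χ m) :=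
    mfderiv_eq_fderiv
  have h5 : mfderiv 𝓘(ℂ, E) 𝓘(ℂ, {i : ι' // i ∉ Set.range P.map} → ℂ) (T ∘ χ) m v =
      (mfderiv 𝓘(ℂ, E) 𝓘(ℂ, {i : ι' // i ∉ Set.range P.map} → ℂ) T (χ m))
        (mfderiv 𝓘(ℂ, E) 𝓘(ℂ, E) χ m v) :=
    congrArg (fun L ↦ L v) h3
  have h5' : mfderiv 𝓘(ℂ, E) 𝓘(ℂ, {i : ι' // i ∉ Set.range P.map} → ℂ) A₀ m v =
      mfderiv 𝓘(ℂ, E) 𝓘(ℂ, {i : ι' // i ∉ Set.range P.map} → ℂ) (T ∘ χ) m v :=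
    congrArg (fun L ↦ L v) h2
  have key' : (mfderiv 𝓘(ℂ, E) 𝓘(ℂ, {i : ι' // i ∉ Set.range P.map} → ℂ) T (χ m))
      (mfderiv 𝓘(ℂ, E) 𝓘(ℂ, E) χ m v) = 0 :=
    h5.symm.trans (h5'.symm.trans hA₀v)
  have key : fderiv ℂ T (χ m) (mfderiv 𝓘(ℂ, E) 𝓘(ℂ, E) χ m v) = 0 :=
    (congrArg (fun L ↦ L (mfderiv 𝓘(ℂ, E) 𝓘(ℂ, E) χ m v)) h4).symm.trans key'
  have hker : mfderiv 𝓘(ℂ, E) 𝓘(ℂ, E) χ m v = 0 :=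
    (injective_iff_map_eq_zero _).1 hbij.1 _ key
  have h6 : mfderiv 𝓘(ℂ, E) 𝓘(ℂ, E) χ m = tangentCoordChange 𝓘(ℂ, E) m m m :=
    mfderiv_chartAt_eq_tangentCoordChange (I := 𝓘(ℂ, E)) (mem_chart_source E m)
  have h7 : tangentCoordChange 𝓘(ℂ, E) m m m v = v :=
    tangentCoordChange_self (I := 𝓘(ℂ, E)) (mem_extChartAt_source m)
  have h8 : tangentCoordChange 𝓘(ℂ, E) m m m v = 0 := by
    rw [h6] at hker
    exact hker
  exact h7.symm.trans h8

/-- **Positivity of the candidate form**: `θ(v, Jv) > 0` for `v ≠ 0`. By the Cauchy–Schwarz kernel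
of the Fubini–Study form, `θ(v, Jv) = 0` gives `dGⱼ(m) v = r · Gⱼ(m)`; the `j`-th coordinate of
`Gⱼ` being constant (`= 1`) near `m`, `r = 0`, so `dGⱼ(m) v = 0` and `v = 0` by
`eq_zero_of_mfderiv_coordFun_apply_eq_zero` (Voisin (2002), §3.3.2 Lemma 3.16: `ω` is positive; on a
submanifold the restricted form is the Kähler form of the induced metric, §3.1.3).
[cite: VoisinHodgeI2002, §3.3.2 Lemma 3.16] -/
theorem fubiniStudyPullbackForm_pos (m : M) (v : TangentSpace 𝓘(ℝ, E) m) (hv : v ≠ 0) :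
    0 < fubiniStudyPullbackForm E ι φ m ![v, tangentJ E m v] := by
  set j := chartIndex (ι := ι) (φ := φ) m with hj
  have hm : m ∈ chartDom ι φ j := mem_chartDom_chartIndex m
  refine lt_of_le_of_ne (fubiniStudyPullbackForm_self_tangentJ_nonneg hφ m v) fun h0 ↦ hv ?_
  -- `dG_j(m) v = r • G_j(m)`
  obtain ⟨r, hr⟩ := exists_mvfderiv_eq_smul_of_fsPullback_eq_zero
    (mdifferentiableAt_coordVec hφ hm) (coordVec_ne_zero hm) h0.symm
  -- the derivative of the coordinate tuple
  have hcF : MDifferentiableAt 𝓘(ℂ, E) 𝓘(ℂ, Fin (N + 1) → ℂ) (coordFun ι φ j) m := by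
    rw [← mdifferentiableWithinAt_univ]
    refine Literature.Geometry.Kaehler.mdifferentiableWithinAt_pi_space.2 fun i ↦ ?_
    rw [mdifferentiableWithinAt_univ]
    exact mdifferentiableAt_coordFun hφ hm i
  have hcomp : ∀ i, mfderiv 𝓘(ℂ, E) 𝓘(ℂ, ℂ) (fun x ↦ coordFun ι φ j x i) m v =
      (mfderiv 𝓘(ℂ, E) 𝓘(ℂ, Fin (N + 1) → ℂ) (coordFun ι φ j) m v) i := by
    intro i
    have hc := mfderiv_comp m
      ((ContinuousLinearMap.proj (R := ℂ) (φ := fun _ : Fin (N + 1) ↦ ℂ) i).hasMFDerivAt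
        (x := coordFun ι φ j m)).mdifferentiableAt hcF
    rw [ContinuousLinearMap.mfderiv_eq] at hc
    exact congrArg (fun L ↦ L v) hc
  -- `d(coordFun) v = equiv (d(coordVec) v) = r • coordFun m`
  have hvec : mfderiv 𝓘(ℂ, E) 𝓘(ℂ, Fin (N + 1) → ℂ) (coordFun ι φ j) m v =
      r • coordFun ι φ j m := by
    have he := mfderiv_comp m
      ((EuclideanSpace.equiv (Fin (N + 1)) ℂ).hasMFDerivAt (x := coordVec ι φ j m)).mdifferentiableAt
      (mdifferentiableAt_coordVec hφ hm)
    rw [ContinuousLinearEquiv.mfderiv_eq] at he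
    rw [coordFun_eq_equiv_coordVec, he]
    change (EuclideanSpace.equiv (Fin (N + 1)) ℂ) (mvfderiv 𝓘(ℂ, E) (coordVec ι φ j) m v) = _
    rw [hr, map_smul]
    rfl
  -- the `j`-th coordinate is constant near `m`, so `r = 0`
  have hconst : mfderiv 𝓘(ℂ, E) 𝓘(ℂ, ℂ) (fun x ↦ coordFun ι φ j x j) m v = 0 := by
    have hev : (fun x ↦ coordFun ι φ j x j) =ᶠ[𝓝 m] fun _ ↦ (1 : ℂ) := by
      filter_upwards [(isOpen_chartDom hφ j).mem_nhds hm] with x hx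
      exact coordFun_self hx
    rw [hev.mfderiv_eq, mfderiv_const]
    rfl
  have hr0 : r = 0 := by
    have := hcomp j
    rw [hconst, hvec, Pi.smul_apply, coordFun_self hm, smul_eq_mul, mul_one] at this
    exact this.symm
  -- hence all coordinate differentials kill `v`
  refine eq_zero_of_mfderiv_coordFun_apply_eq_zero hφ hm fun i ↦ ?_
  rw [hcomp i, hvec, hr0, zero_smul]
  rfl

end Immersion

end Analytic

end AnalytificationKaehler

/-! ## Part C. Conclusion -/

section Conclusion

open Literature.NumberTheory.Transcendental Literature.Geometry.Kaehler AnalytificationKaehler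
open scoped Manifold ContDiff

variable {k : Type} [Field k] [Algebra k ℂ] {X : SchemeOver k}
  {d : ℕ} {E : Type*} [NormedAddCommGroup E] [NormedSpace ℂ E] [FiniteDimensional ℂ E]
  {M : Type*} [TopologicalSpace M] [ChartedSpace E M] {φ : M → ComplexPoints X}

/-- **Smooth projective varieties are Kähler** (discharge of the named fact
`Literature.AlgebraicGeometry.Motives.isKaehlerManifold_of_isAnalytification_of_isClosedImmersion` of
`GAGA.lean`): for a smooth `k`-scheme `X` (`k ⊆ ℂ`) of relative dimension `d` with a closed
`k`-immersion `ι : X ⟶ ℙᴺ_k`, every analytification `φ : M → X(ℂ)` with a holomorphic atlas is a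
Kähler manifold: the pulled-back Fubini–Study form `fubiniStudyPullbackForm ι φ` is a smooth closed
positive real `(1,1)`-form, whence a Kähler metric `g(v, w) = θ(v, Jw)`
(`isKaehlerManifold_of_closed_positive_form`). Voisin (2002), §3.3.2, Lemma 3.16 and the corollary
p. 77 («every complex projective manifold is Kähler»), with §3.1.3 (submanifolds of Kähler
manifolds) and §3.1.1 Lemma 3.3; Griffiths–Harris (1978), p. 109.
[cite: VoisinHodgeI2002, §3.3.2 Lemma 3.16 and p. 77] -/
theorem isKaehlerManifold_of_isAnalytification_of_isClosedImmersion_holds :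
    isKaehlerManifold_of_isAnalytification_of_isClosedImmersion (k := k) (X := X) (d := d)
      (E := E) (M := M) (φ := φ) := by
  intro _ _ _ N ι _ hφ
  exact isKaehlerManifold_of_closed_positive_form (fubiniStudyPullbackForm E ι φ)
    (isSmoothForm_fubiniStudyPullbackForm hφ) (isClosedForm_fubiniStudyPullbackForm hφ)
    (fubiniStudyPullbackForm_tangentJ hφ) (fubiniStudyPullbackForm_pos hφ)

end Conclusion

end Literature.AlgebraicGeometry.Motives
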